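import Mathlib
import Summits.ValiantsHypothesis.ValiantsHypothesis.Theorems.GrenetZeonPolySizeQPAlgebraSquareZeroAlgebra
import HarnessLib

/-!
# Crux `GrenetZeon.PolySizeQPAlgebra` (stmt-ValiantsHypothesis-8064), line `vbp-slice-dealg` —
# square-zero coefficient algebras: the local Hessian bound at EVERY point and every `n`

`…SquareZeroAlgebra` proved the type-independent local Hessian bound for square-zero coefficient algebras
when `n ≥ 5`, losing the corner "residual corank `3`, `n ≤ 4`" to the crude count `rank ≤ q²·dim R` of the
second polarisation.  Here the count is refined through RESIDUES: with a square-zero residual block the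
second polarisation depends on the perturbation only through its residue matrix, so its read-out has rank
`≤ q²`, and the corner disappears:

* `det_updateRow_eq_of_residue_eq` — with a square-zero kernel and another row in the kernel, replacing a
  row by any row with the same residues does not change the determinant.
* `rank_secondPolar_readOut_le_sq_of_sqZero` — the second-polarisation read-out for `S ∈ Mat_m(ker φ)`,
  `|m| ≥ 3`, has rank `≤ |m|²` (it factors through `φ(X_s) ∈ Mat_m(ℂ)`).
* `rank_hess0_transl_le_sq_of_sqZero_normalForm` — at a normal form `diag(1_κ, S)`, `S ∈ Mat_m(ker φ)`,
  `|m| ≥ 3`: `rank Hess λ(det A)(p) ≤ |m|²`.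
* `rank_hess0_transl_le_of_sqZero_algebra_of_two_le_finrank` — **for every finite-dimensional commutative
  `ℂ`-algebra `R` of dimension `≥ 2` with a character of SQUARE-ZERO kernel, every functional `λ`, every
  affine `n × n` matrix `A` (any `n`) and every point `p` with `det A(p) = 0` in `R`:
  `rank Hess λ(det A)(p) ≤ 2 · dim_ℂ R · n`.**  (`dim R = 1`, i.e. `R = ℂ`, is Mignon–Ressayre's case,
  covered in the tree by the unimodular-kernel-vector form of `…ResidualCorankOne`.)

So the input `LocalHessianBound` of `…LocalReduction` is a THEOREM for all square-zero local types
(`ℂ[x]/x²`, `ℂ[x,y]/(x,y)²`, `ℂ[x,y,z]/(x,y,z)²`, …) — previously only curvilinear types (`…JetHessian`)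
and residual corank `≤ 2` (`…ResidualCorankTwo`) were covered.  Non-square-zero, non-curvilinear types at
residual corank `≥ 3` (first instance: `ℂ[x,y]/(x², y²)`, the residual type of the rung `(n,4)`) remain.
HONEST FRAMING: a rank theorem for a class of coefficient algebras; no stub of the line is closed;
VP ≠ VNP is not moved.

References: T. Mignon, N. Ressayre, IMRN 2004:79, §2 [MignonRessayre2004].
-/

noncomputable section

open MvPolynomial Matrix
open Literature.Computability.AlgebraicComplexity

-- single-conjunct layout `Summits/ValiantsHypothesis/ValiantsHypothesis`: duplicated namespace by design
set_option linter.dupNamespace false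

namespace Summit.ValiantsHypothesis.ValiantsHypothesis.Theorems.GrenetZeonPolySizeQPAlgebra

section Residue

variable {R : Type*} [CommRing R] [Algebra ℂ R] {m : Type*} [Fintype m] [DecidableEq m]

/-- **Residue replacement in a row.**  If the kernel of `φ` is square-zero, some row `p ≠ q` of `M` lies in
`ker φ`, and two candidate rows `x, x'` have the same residues, then replacing row `q` by `x` or by `x'`
gives the same determinant (the difference has two rows in `ker φ`). [folklore] -/
theorem det_updateRow_eq_of_residue_eq (φ : R →ₐ[ℂ] ℂ) (hsq : ∀ a b : R, φ a = 0 → φ b = 0 → a * b = 0)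
    (M : Matrix m m R) {p q : m} (hpq : p ≠ q) (hp : ∀ j, φ (M p j) = 0) (x x' : m → R)
    (hx : ∀ j, φ (x j) = φ (x' j)) : (M.updateRow q x).det = (M.updateRow q x').det := by
  have hsplit : x = x' + (x - x') := by abel
  rw [hsplit, Matrix.det_updateRow_add, add_eq_left]
  refine det_eq_zero_of_two_rows_mem_sqZero (RingHom.ker (φ : R →+* ℂ))
    (fun a ha b hb => hsq a b (by simpa using ha) (by simpa using hb)) _ hpq (fun j => ?_) (fun j => ?_)
  · rw [Matrix.updateRow_ne hpq, RingHom.mem_ker]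
    exact hp j
  · rw [Matrix.updateRow_self, RingHom.mem_ker, Pi.sub_apply, AlgHom.coe_toRingHom, map_sub, hx j,
      sub_self]

variable [Module.Finite ℂ R] {σ : Type*} [Fintype σ]

omit [Module.Finite ℂ R] in
/-- **Residue form of the second-polarisation read-out for a square-zero residual block.**  If `ker φ`
is square-zero, `S ∈ Mat_m(ker φ)` with `|m| ≥ 3`, then
`(s,t) ↦ λ(Σ_r Σ_{q≠r} det(S | row r ← (Y_t)_r, row q ← (X_s)_q))` depends on `X_s` only through its
residue matrix `φ(X_s) ∈ Mat_m(ℂ)`, hence has rank `≤ |m|²` (instead of `|m|²·dim R`). [folklore] -/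
theorem rank_secondPolar_readOut_le_sq_of_sqZero (φ : R →ₐ[ℂ] ℂ)
    (hsq : ∀ a b : R, φ a = 0 → φ b = 0 → a * b = 0) (l : R →ₗ[ℂ] ℂ) (S : Matrix m m R)
    (hS : ∀ i j, φ (S i j) = 0) (hm : 3 ≤ Fintype.card m) (Xf Yf : σ → Matrix m m R) :
    (Matrix.of fun s t => l (∑ r, ∑ q, if q = r then 0 else
        ((S.updateRow r (Yf t r)).updateRow q (Xf s q)).det)).rank ≤
      Fintype.card m * Fintype.card m := by
  classical
  set c : ℂ → R := fun z => algebraMap ℂ R z with hc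
  -- replace the row `(X_s)_q` by the lift of its residue
  have hres : ∀ (r q : m), q ≠ r → ∀ (y x : m → R),
      ((S.updateRow r y).updateRow q x).det = ((S.updateRow r y).updateRow q (fun j => c (φ (x j)))).det := by
    intro r q hqr y x
    obtain ⟨p₀, hp₀, -⟩ : ∃ p₀ ∈ ((Finset.univ : Finset m).erase r).erase q, True := by
      have hcard : 0 < (((Finset.univ : Finset m).erase r).erase q).card := by
        have h1 : ((Finset.univ : Finset m).erase r).card = Fintype.card m - 1 := by
          rw [Finset.card_erase_of_mem (Finset.mem_univ r), Finset.card_univ]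
        have h3 : (((Finset.univ : Finset m).erase r).erase q).card ≥
            ((Finset.univ : Finset m).erase r).card - 1 := Finset.pred_card_le_card_erase
        omega
      obtain ⟨p₀, hp₀⟩ := Finset.card_pos.1 hcard
      exact ⟨p₀, hp₀, trivial⟩
    have hp₀q : p₀ ≠ q := (Finset.mem_erase.1 hp₀).1
    have hp₀r : p₀ ≠ r := (Finset.mem_erase.1 (Finset.mem_erase.1 hp₀).2).1
    refine det_updateRow_eq_of_residue_eq φ hsq _ hp₀q (fun j => ?_) _ _ (fun j => ?_)
    · rw [Matrix.updateRow_ne hp₀r]; exact hS _ _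
    · rw [hc, AlgHom.commutes, Algebra.algebraMap_self, RingHom.id_apply]
  -- the functionals on the residue matrices
  have hadd : ∀ (t : σ) (M N : Matrix m m ℂ),
      (∑ r, ∑ q, if q = r then (0 : R) else
        ((S.updateRow r (Yf t r)).updateRow q (fun j => c ((M + N) q j))).det) =
      (∑ r, ∑ q, if q = r then (0 : R) else
        ((S.updateRow r (Yf t r)).updateRow q (fun j => c (M q j))).det) +
      ∑ r, ∑ q, if q = r then (0 : R) else
        ((S.updateRow r (Yf t r)).updateRow q (fun j => c (N q j))).det := by
    intro t M N
    rw [← Finset.sum_add_distrib]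
    refine Finset.sum_congr rfl fun r _ => ?_
    rw [← Finset.sum_add_distrib]
    refine Finset.sum_congr rfl fun q _ => ?_
    split_ifs with h
    · rw [add_zero]
    · rw [show (fun j => c ((M + N) q j)) = (fun j => c (M q j)) + fun j => c (N q j) by
        funext j; simp [hc, Matrix.add_apply], Matrix.det_updateRow_add]
  have hsmul : ∀ (t : σ) (a : ℂ) (M : Matrix m m ℂ),
      (∑ r, ∑ q, if q = r then (0 : R) else
        ((S.updateRow r (Yf t r)).updateRow q (fun j => c ((a • M) q j))).det) =
      c a * ∑ r, ∑ q, if q = r then (0 : R) else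
        ((S.updateRow r (Yf t r)).updateRow q (fun j => c (M q j))).det := by
    intro t a M
    rw [Finset.mul_sum]
    refine Finset.sum_congr rfl fun r _ => ?_
    rw [Finset.mul_sum]
    refine Finset.sum_congr rfl fun q _ => ?_
    split_ifs with h
    · rw [mul_zero]
    · rw [show (fun j => c ((a • M) q j)) = c a • fun j => c (M q j) by
        funext j; simp [hc, Matrix.smul_apply], Matrix.det_updateRow_smul]
  let ψ : σ → (Matrix m m ℂ →ₗ[ℂ] ℂ) := fun t =>
    { toFun := fun M => l (∑ r, ∑ q, if q = r then 0 else
        ((S.updateRow r (Yf t r)).updateRow q (fun j => c (M q j))).det)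
      map_add' := fun M N => by rw [hadd, map_add]
      map_smul' := fun a M => by rw [hsmul, hc, ← Algebra.smul_def, map_smul, RingHom.id_apply] }
  have h : (Matrix.of fun s t => l (∑ r, ∑ q, if q = r then 0 else
      ((S.updateRow r (Yf t r)).updateRow q (Xf s q)).det)) =
      Matrix.of fun s t => ψ t ((Xf s).map φ) := by
    ext s t
    simp only [Matrix.of_apply]
    change _ = l _
    congr 1
    refine Finset.sum_congr rfl fun r _ => Finset.sum_congr rfl fun q _ => ?_
    split_ifs with hqr
    · rfl
    · rw [hres r q hqr]
      rfl
  rw [h]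
  refine (rank_linear_readOut_le (fun s => (Xf s).map φ) ψ).trans ?_
  rw [Module.finrank_matrix ℂ ℂ m m, Module.finrank_self, mul_one]

variable [DecidableEq σ] {κ : Type*} [Fintype κ] [DecidableEq κ]

omit [Module.Finite ℂ R] in
/-- **Square-zero normal form of residual corank `q ≥ 3`: `rank Hess ≤ q²`.**  At `A(p) = diag(1_κ, S)`
with `S ∈ Mat_m(ker φ)`, `ker φ` square-zero and `|m| ≥ 3`, only the second polarisation survives and it
factors through the residue matrix: `rank Hess λ(det A)(p) ≤ |m|²`. [cite: MignonRessayre2004, §2] -/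
theorem rank_hess0_transl_le_sq_of_sqZero_normalForm (φ : R →ₐ[ℂ] ℂ)
    (hsq : ∀ a b : R, φ a = 0 → φ b = 0 → a * b = 0) (l : R →ₗ[ℂ] ℂ)
    (A : Matrix (κ ⊕ m) (κ ⊕ m) (MvPolynomial σ R)) (F : MvPolynomial σ ℂ)
    (hA : ∀ a b, (A a b).totalDegree ≤ 1) (hF : ∀ d, l (coeff d A.det) = coeff d F)
    (p : σ → ℂ) (S : Matrix m m R)
    (hB : A.map (eval fun i => algebraMap ℂ R (p i)) = Matrix.fromBlocks 1 0 0 S)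
    (hS : ∀ i j, φ (S i j) = 0) (hm : 3 ≤ Fintype.card m) :
    (hess0 (transl p F)).rank ≤ Fintype.card m * Fintype.card m := by
  classical
  have hI : ∀ a ∈ RingHom.ker (φ : R →+* ℂ), ∀ b ∈ RingHom.ker (φ : R →+* ℂ), a * b = 0 :=
    fun a ha b hb => hsq a b (by simpa using ha) (by simpa using hb)
  have hS' : ∀ i j, S i j ∈ RingHom.ker (φ : R →+* ℂ) := fun i j => by simpa using hS i j
  set x : σ → R := fun i => algebraMap ℂ R (p i) with hx
  set Xf : σ → Matrix m m R := fun s => (A.map fun a => eval x (pderiv s a)).toBlocks₂₂ with hXf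
  have hH : hess0 (transl p F) = Matrix.of fun s t => l (∑ r, ∑ q, if q = r then 0 else
      ((S.updateRow r (Xf t r)).updateRow q (Xf s q)).det) := by
    ext s t
    rw [hess0_transl_readOut l hF p s t,
      eval_pderiv_pderiv_det_blockNormalForm_general x s t A hA S hB _ _ rfl rfl,
      adjugate_eq_zero_of_mem_sqZero _ hI S hS' hm, det_eq_zero_of_mem_sqZero _ hI S hS' (by omega),
      Matrix.of_apply]
    simp only [Matrix.zero_mul, Matrix.trace_zero, mul_zero, add_zero, zero_add, hXf]
  rw [hH]
  exact rank_secondPolar_readOut_le_sq_of_sqZero φ hsq l S hS hm Xf Xf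

/-- **Square-zero algebras of dimension `≥ 2`: `LocalHessianBound` at every point, every `n`.**  For a
finite-dimensional commutative `ℂ`-algebra `R` with a character `φ` of square-zero kernel and
`dim_ℂ R ≥ 2`, every functional `λ`, every affine `n × n` matrix `A` with read-out `F = λ(det A)` and every
point `p` with `det A(p) = 0` in `R`: `rank Hess F(p) ≤ 2 · dim_ℂ R · n` (residual corank `≤ 2`:
`…ResidualCorankTwo`; `= 3`: `rank ≤ 9 ≤ 2·dim R·n` by the residue form (`n ≥ 3`, `dim R ≥ 2`); for `q ≥ 4`, the vanishing; `n ≤ 1` directly).  The case `dim R = 1` (`R = ℂ`) is Mignon–Ressayre's.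
[cite: MignonRessayre2004, §2] -/
theorem rank_hess0_transl_le_of_sqZero_algebra_of_two_le_finrank {n : ℕ} (φ : R →ₐ[ℂ] ℂ)
    (hsq : ∀ a b : R, φ a = 0 → φ b = 0 → a * b = 0) (hR : 2 ≤ Module.finrank ℂ R) (l : R →ₗ[ℂ] ℂ)
    (A : Matrix (Fin n) (Fin n) (MvPolynomial σ R)) (F : MvPolynomial σ ℂ)
    (hA : ∀ a b, (A a b).totalDegree ≤ 1) (hF : ∀ d, l (coeff d A.det) = coeff d F) (p : σ → ℂ)
    (hp : eval (fun i => algebraMap ℂ R (p i)) A.det = 0) :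
    (hess0 (transl p F)).rank ≤ 2 * Module.finrank ℂ R * n := by
  classical
  haveI : Nontrivial R := RingHom.domain_nontrivial (φ : R →+* ℂ)
  -- tiny sizes
  rcases Nat.lt_or_ge n 2 with hn | hn
  · interval_cases n
    · exfalso
      rw [Matrix.det_isEmpty, map_one] at hp
      exact one_ne_zero hp
    · have hB1 : (A.map (eval fun i => algebraMap ℂ R (p i))).det = 0 := by
        rw [← RingHom.mapMatrix_apply, ← RingHom.map_det, hp]
      have hmv : Matrix.mulVec (A.map (eval fun i => algebraMap ℂ R (p i))) (fun _ => (1 : R)) = 0 := by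
        ext i
        fin_cases i
        rw [Matrix.det_fin_one, Matrix.map_apply] at hB1
        simp [Matrix.mulVec, dotProduct, hB1]
      simpa using rank_hess0_transl_le_of_mulVec_eq_zero l A F hA hF p (fun _ => (1 : R)) hmv
        ⟨0, isUnit_one⟩
  set B : Matrix (Fin n) (Fin n) R := A.map (eval fun i => algebraMap ℂ R (p i)) with hB
  obtain ⟨k, r, c, hu, hmax⟩ := exists_maximal_residual_minor (φ : R →+* ℂ) B
  have hr : Function.Injective r := by
    intro i j hij
    by_contra hne
    apply hu
    rw [Matrix.det_zero_of_row_eq hne (funext fun l => by simp only [Matrix.submatrix_apply, hij]),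
      map_zero]
  have hkn : k ≤ n := by simpa using Fintype.card_le_of_injective r hr
  by_cases hk2 : n ≤ k + 2
  · obtain ⟨d, hd⟩ : ∃ d, k = (n - 2) + d := ⟨k - (n - 2), by omega⟩
    subst hd
    obtain ⟨r', c', h'⟩ := exists_residual_minor_sub (φ : R →+* ℂ) B (n - 2) d r c hu
    have h := rank_hess0_transl_le_of_residual_minor_ne_zero φ (ker_pow_two_eq_bot_of_sqZero φ hsq)
      l A F hA hF p hp r' c' h' (by simp only [Fintype.card_fin]; omega)
    simpa only [Fintype.card_fin] using h
  · obtain ⟨q, hq⟩ : ∃ q, n = k + q := ⟨n - k, by omega⟩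
    rcases Nat.lt_or_ge q 4 with hq4 | hq4
    · have hq3 : q = 3 := by omega
      subst hq3
      have h := rank_hess0_transl_le_of_maximal_minor (m := Fin 3) φ
        (ker_pow_two_eq_bot_of_sqZero φ hsq) l A F hA hF p r c hu hmax
        (by simp only [Fintype.card_fin]; omega)
        fun l' A' S hA' hF' hB' hS' =>
          rank_hess0_transl_le_sq_of_sqZero_normalForm φ hsq l' A' F hA' hF' p S hB' hS'
            (by simp only [Fintype.card_fin]; omega)
      simp only [Fintype.card_fin] at h
      have h12 : 12 ≤ 2 * Module.finrank ℂ R * n := by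
        calc 12 = 2 * 2 * 3 := by norm_num
          _ ≤ 2 * Module.finrank ℂ R * n :=
            Nat.mul_le_mul (Nat.mul_le_mul_left 2 hR) (by omega)
      omega
    · have h := hess0_transl_rank_eq_zero_of_sqZero_point (m := Fin q) φ hsq l A F hA hF p r c hu
        hmax (by simp only [Fintype.card_fin]; omega) (by simpa only [Fintype.card_fin] using hq4)
      rw [h]
      exact Nat.zero_le _

end Residue

end Summit.ValiantsHypothesis.ValiantsHypothesis.Theorems.GrenetZeonPolySizeQPAlgebra

end
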